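import Literature.Computability.Cryptography.GoldreichLevinPredictor
import Literature.Computability.Complexity.SipserCodingLemma
import HarnessLib

/-!
# Complexity meta: the hybrid argument for `DP_k` with a `k`-bit advice (Hirahara 2021, Lemma 3.14), exact counting form

Topic `Literature/Computability/MetaComplexity`. Math layer (no machines, only identities and
inequalities between finite counts over `BVec n = Fin n → 𝔽₂`) of the *advice* route to the
reconstruction property of the `k`-wise direct product generator
`DP_k(x; z₁,…,z_k) = (z₁,…,z_k, ⟨x,z₁⟩,…,⟨x,z_k⟩)` (S. Hirahara, ECCC TR21-058 = STOC 2021, Lemma 3.14,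
"We use a standard hybrid argument (as in [NW94, Vad12])"), which — unlike the advice-free XOR-lemma
route of `DPReconstructionGL.lean` — loses only a factor `k` (not `2^k`) in the advantage, at the price
of the `k` advice bits `⟨x,z₁⟩,…,⟨x,z_{j}⟩`; this is what the `K`-complexity form of Thm. 3.12
(`K(x) ≤ k + O(log)`) needs.

* `DPHyb.hyb j x z u` — the `j`-th hybrid bit vector: the first `j` bits real (`⟨x, zᵢ⟩`), the others
  from `u`; `DPHyb.H T x j` — the acceptance count of the test `T` on the `j`-th hybrid;
  `H_zero` (`= Id`, all bits uniform), `H_of_le` (`= 2^k · Re`, all bits real);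
* `DPHyb.exists_hybrid_gap` — **telescoping**: some consecutive pair of hybrids carries a `1/k`
  fraction of the total gap;
* `DPHyb.predZ T j sgn x c r` — **Yao's predictor** of `⟨x, r⟩` from the gap at `j`: put `r` in block
  `j`, feed the hybrid bits (real below `j` — the advice —, the coin `u_j` at `j`, uniform above), answer
  `u_j` if `T` accepts and `u_j + 1` otherwise (then add the sign `sgn`);
* `DPHyb.two_mul_card_agree_eq` — the **exact agreement identity**
  `2·#{(c, r) | predZ = ⟨x,r⟩} = 2ⁿ·(#C + 2H_{j+1} − 2H_j)` (sign `0`), and `card_agree_ge` — with the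
  right sign the predictor agrees with `⟨x, ·⟩` on a `≥ 1/2 + |H_{j+1} − H_j|/#C` fraction of (coins, query);
* `DPHyb.reconstruction_count` — **Lemma 3.14, counting form**: if `|2^k·Re − Id| ≥ δ·#C` then for the
  `(j, sgn)` of the telescoping step, Rackoff's candidate computed from the predictor with coins `c`,
  seeds `s` and guess `τ` equals `x` for at least a `δ/(8k·2^kk)` fraction of `(c, s, τ)`, provided
  `n ≤ 2(δ/(4k))²(2^kk − 1)` (averaging `card_goodRows_ge` + `GLPred.goldreich_levin_cand`).

## References

* S. Hirahara, *Average-case hardness of NP from exponential worst-case hardness assumptions*, ECCC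
  TR21-058 (2021), Lemma 3.14 and its proof (pp. 23–24), Thm. 3.12.
* A. C.-C. Yao, *Theory and applications of trapdoor functions*, FOCS 1982 (next-bit predictor).
* N. Nisan, A. Wigderson, *Hardness vs randomness*, JCSS 49 (1994), Lemma 2.4 (the hybrid argument).
* S. Arora, B. Barak, *Computational Complexity: A Modern Approach*, CUP 2009, Thm. 9.11 (Yao), Thm. 9.12 (GL).
-/

namespace Literature.Computability.MetaComplexity

open Finset Matrix Literature.Computability.Cryptography Literature.Computability.Complexity

namespace DPHyb

variable {n k : ℕ}

/-! ### Hybrids -/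

/-- **The `j`-th hybrid bit vector**: bit `i` is the real inner product `⟨x, zᵢ⟩` for `i < j` and the
coin `uᵢ` for `i ≥ j` (`j = 0`: all uniform; `j ≥ k`: all real). [cite: Hirahara2021, Lemma 3.14 (proof)] -/
def hyb (j : ℕ) (x : BVec n) (z : Fin k → BVec n) (u : BVec k) : BVec k :=
  fun i => if (i : ℕ) < j then x ⬝ᵥ z i else u i

/-- **The acceptance count of the `j`-th hybrid**: `H_j = #{(z, u) | T(z, hyb_j) = 1}`.
[cite: Hirahara2021, Lemma 3.14 (proof)] -/
def H (T : (Fin k → BVec n) → BVec k → Bool) (x : BVec n) (j : ℕ) : ℕ :=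
  (univ.filter fun q : (Fin k → BVec n) × BVec k => T q.1 (hyb j x q.1 q.2) = true).card

/-- Hybrid `0` is the coin vector. [folklore] -/
@[simp] theorem hyb_zero (x : BVec n) (z : Fin k → BVec n) (u : BVec k) : hyb 0 x z u = u := by
  funext i; simp [hyb]

/-- Hybrids `j ≥ k` are the real bit vector. [folklore] -/
theorem hyb_of_le {j : ℕ} (hj : k ≤ j) (x : BVec n) (z : Fin k → BVec n) (u : BVec k) :
    hyb j x z u = fun i => x ⬝ᵥ z i := by
  funext i; simp [hyb, lt_of_lt_of_le i.isLt hj]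

/-- `H_0 = Id`, the ideal acceptance count over `(z, u)`. [cite: Hirahara2021, Lemma 3.14 (proof)] -/
theorem H_zero (T : (Fin k → BVec n) → BVec k → Bool) (x : BVec n) :
    H T x 0 = (univ.filter fun q : (Fin k → BVec n) × BVec k => T q.1 q.2 = true).card := by
  simp [H]

/-- `H_j = 2^k · Re` for `j ≥ k`, `Re` the real acceptance count over `z`. [cite: Hirahara2021, Lemma 3.14 (proof)] -/
theorem H_of_le (T : (Fin k → BVec n) → BVec k → Bool) (x : BVec n) {j : ℕ} (hj : k ≤ j) :
    H T x j = 2 ^ k * (univ.filter fun z : Fin k → BVec n => T z (fun i => x ⬝ᵥ z i) = true).card := by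
  classical
  unfold H
  simp only [hyb_of_le hj]
  rw [show (univ.filter fun q : (Fin k → BVec n) × BVec k => T q.1 (fun i => x ⬝ᵥ q.1 i) = true) =
      (univ.filter fun z : Fin k → BVec n => T z (fun i => x ⬝ᵥ z i) = true) ×ˢ (univ : Finset (BVec k)) by
    ext q; simp]
  rw [card_product, card_univ, Fintype.card_fun, ZMod.card, Fintype.card_fin, mul_comm]

/-- **Telescoping**: for `k ≥ 1` some consecutive pair of hybrids carries a `1/k` fraction of the
total gap: `|H_k − H_0| ≤ k · |H_{j+1} − H_j|`. [cite: Hirahara2021, Lemma 3.14 (proof)] -/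
theorem exists_hybrid_gap (T : (Fin k → BVec n) → BVec k → Bool) (x : BVec n) (hk : 0 < k) :
    ∃ j : Fin k, |(H T x k : ℝ) - H T x 0| ≤ k * |(H T x (j + 1) : ℝ) - H T x j| := by
  by_contra hno
  push Not at hno
  have htel : (H T x k : ℝ) - H T x 0 = ∑ j ∈ range k, ((H T x (j + 1) : ℝ) - H T x j) :=
    (Finset.sum_range_sub (fun j => (H T x j : ℝ)) k).symm
  have habs : |(H T x k : ℝ) - H T x 0| ≤ ∑ j ∈ range k, |(H T x (j + 1) : ℝ) - H T x j| := by
    rw [htel]; exact Finset.abs_sum_le_sum_abs _ _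
  have hlt : ∑ j ∈ range k, (k : ℝ) * |(H T x (j + 1) : ℝ) - H T x j| <
      ∑ _j ∈ range k, |(H T x k : ℝ) - H T x 0| := by
    refine Finset.sum_lt_sum_of_nonempty (Finset.nonempty_range_iff.2 hk.ne') fun j hj => ?_
    exact hno ⟨j, Finset.mem_range.1 hj⟩
  rw [Finset.sum_const, card_range, nsmul_eq_mul, ← Finset.mul_sum] at hlt
  have hk' : (0 : ℝ) < k := by exact_mod_cast hk
  nlinarith [mul_le_mul_of_nonneg_left habs hk'.le]

/-! ### Yao's predictor from the gap at `j` -/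

/-- **Yao's next-bit predictor, read as a predictor of `⟨x, r⟩`** (coins `c = (z, u)`, query `r`):
put `r` in block `j`, feed the hybrid bits `hyb_j` (the advice `⟨x,zᵢ⟩` for `i < j`, the coin `u_j`
at `j`, the coins above), and answer `u_j` if the test accepts, `u_j + 1` otherwise; `sgn` flips the
answer. [cite: Hirahara2021, Lemma 3.14 (proof)] -/
def predZ (T : (Fin k → BVec n) → BVec k → Bool) (j : Fin k) (sgn : ZMod 2) (x : BVec n)
    (c : (Fin k → BVec n) × BVec k) (r : BVec n) : ZMod 2 :=
  (if T (Function.update c.1 j r) (hyb j x c.1 c.2) = true then c.2 j else c.2 j + 1) + sgn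

/-- The hybrid bits below block `j` do not see block `j`. [folklore] -/
theorem hyb_update (j : Fin k) (x : BVec n) (z : Fin k → BVec n) (u : BVec k) (r : BVec n) :
    hyb j x (Function.update z j r) u = hyb j x z u := by
  funext i
  unfold hyb
  split_ifs with h
  · rw [Function.update_of_ne]
    exact fun hij => by subst hij; exact lt_irrefl _ h
  · rfl

/-- In `𝔽₂`, `a ≠ b ↔ a = b + 1` (from `SipserHash.zmod2_add_one_eq_iff`). [folklore] -/
private theorem ne_iff_eq_add_one (a b : ZMod 2) : a ≠ b ↔ a = b + 1 := by
  rw [ne_comm, ← SipserHash.zmod2_add_one_eq_iff, eq_comm]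

section Identity

variable (T : (Fin k → BVec n) → BVec k → Bool) (j : Fin k) (x : BVec n)

/-- The predicate "the (unsigned) predictor is right" after the block swap `(z, r) ↦ (z[j ↦ r], z_j)`:
it no longer mentions the query. [folklore] -/
abbrev Q (q : (Fin k → BVec n) × BVec k) : Prop :=
  (if T q.1 (hyb j x q.1 q.2) = true then q.2 j else q.2 j + 1) = x ⬝ᵥ q.1 j

/-- **Block swap**: the agreement count of the unsigned predictor is `2ⁿ · #{(z, u) | Q}`.
[cite: Hirahara2021, Lemma 3.14 (proof)] -/
theorem card_agree_zero_eq :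
    (univ.filter fun p : ((Fin k → BVec n) × BVec k) × BVec n => predZ T j 0 x p.1 p.2 = x ⬝ᵥ p.2).card =
      2 ^ n * (univ.filter fun q : (Fin k → BVec n) × BVec k => Q T j x q).card := by
  classical
  -- the involution swapping block `j` with the query
  let Φ : ((Fin k → BVec n) × BVec k) × BVec n → ((Fin k → BVec n) × BVec k) × BVec n :=
    fun p => ((Function.update p.1.1 j p.2, p.1.2), p.1.1 j)
  have hΦ : Function.Involutive Φ := by
    rintro ⟨⟨z, u⟩, r⟩
    simp only [Φ, Function.update_self, Function.update_idem, Function.update_eq_self]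
  have hstep : (univ.filter fun p : ((Fin k → BVec n) × BVec k) × BVec n => predZ T j 0 x p.1 p.2 = x ⬝ᵥ p.2).card =
      (univ.filter fun p : ((Fin k → BVec n) × BVec k) × BVec n => Q T j x p.1).card := by
    refine Finset.card_bij' (fun p _ => Φ p) (fun p _ => Φ p) (fun p hp => ?_) (fun p hp => ?_)
      (fun p _ => hΦ p) (fun p _ => hΦ p)
    · rcases p with ⟨⟨z, u⟩, r⟩
      simp only [mem_filter, mem_univ, true_and, predZ, add_zero] at hp
      simpa [Q, Φ, hyb_update] using hp
    · rcases p with ⟨⟨z, u⟩, r⟩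
      simp only [mem_filter, mem_univ, true_and, Q] at hp
      simpa [predZ, Φ, hyb_update] using hp
  rw [hstep]
  rw [show (univ.filter fun p : ((Fin k → BVec n) × BVec k) × BVec n => Q T j x p.1) =
      (univ.filter fun q : (Fin k → BVec n) × BVec k => Q T j x q) ×ˢ (univ : Finset (BVec n)) by
    ext p; simp]
  rw [card_product, card_univ, Fintype.card_fun, ZMod.card, Fintype.card_fin, mul_comm]

/-- Flipping coin `j`: an involution of the coin space exchanging `u_j = β` and `u_j ≠ β`. [folklore] -/
theorem flip_invol : Function.Involutive (fun q : (Fin k → BVec n) × BVec k => (q.1, q.2 + Pi.single j 1)) := by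
  rintro ⟨z, u⟩
  simp only [Prod.mk.injEq, true_and, add_assoc]
  rw [← Pi.single_add]
  have : (1 : ZMod 2) + 1 = 0 := by decide
  rw [this, Pi.single_zero, add_zero]

/-- `(u + e_j)_j = u_j + 1`. [folklore] -/
@[simp] theorem flip_apply_self (u : BVec k) : (u + Pi.single j 1 : BVec k) j = u j + 1 := by
  simp

/-- The hybrid `hyb_j` of the flipped coins differs only in bit `j`; `hyb_{j+1}` not at all. [folklore] -/
theorem hyb_succ_flip (z : Fin k → BVec n) (u : BVec k) :
    hyb ((j : ℕ) + 1) x z (u + Pi.single j 1) = hyb ((j : ℕ) + 1) x z u := by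
  funext i
  unfold hyb
  split_ifs with h
  · rfl
  · have hij : i ≠ j := fun hij => by subst hij; exact h (Nat.lt_succ_self _)
    simp [hij]

/-- When `u_j` is the real bit, `hyb_j = hyb_{j+1}`. [folklore] -/
theorem hyb_eq_hyb_succ_of_eq (z : Fin k → BVec n) (u : BVec k) (hu : u j = x ⬝ᵥ z j) :
    hyb j x z u = hyb ((j : ℕ) + 1) x z u := by
  funext i
  unfold hyb
  by_cases h1 : (i : ℕ) < j
  · simp [h1, Nat.lt_succ_of_lt h1]
  · by_cases h2 : (i : ℕ) < (j : ℕ) + 1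
    · have hij : i = j := Fin.ext (by omega)
      subst hij
      simp [hu]
    · simp [h1, h2]

/-- Half of the coin space has `u_j = ⟨x, z_j⟩`: `2 · #{u_j ≠ β} = #C`. [folklore] -/
theorem two_mul_card_ne_eq :
    2 * (univ.filter fun q : (Fin k → BVec n) × BVec k => q.2 j ≠ x ⬝ᵥ q.1 j).card =
      Fintype.card ((Fin k → BVec n) × BVec k) := by
  classical
  have hflip := flip_invol (n := n) j
  have heq : (univ.filter fun q : (Fin k → BVec n) × BVec k => q.2 j = x ⬝ᵥ q.1 j).card =
      (univ.filter fun q : (Fin k → BVec n) × BVec k => q.2 j ≠ x ⬝ᵥ q.1 j).card := by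
    refine Finset.card_bij' (fun q _ => (q.1, q.2 + Pi.single j 1)) (fun q _ => (q.1, q.2 + Pi.single j 1))
      (fun q hq => ?_) (fun q hq => ?_) (fun q _ => hflip q) (fun q _ => hflip q)
    · simp only [mem_filter, mem_univ, true_and] at hq ⊢
      rw [flip_apply_self, ne_eq, (SipserHash.zmod2_add_one_eq_iff _ _).not, not_not]; exact hq
    · simp only [mem_filter, mem_univ, true_and] at hq ⊢
      rw [flip_apply_self, SipserHash.zmod2_add_one_eq_iff]; exact hq
  have := Finset.card_filter_add_card_filter_not (s := (univ : Finset ((Fin k → BVec n) × BVec k)))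
    (fun q => q.2 j = x ⬝ᵥ q.1 j)
  rw [card_univ] at this
  simp only [ne_eq] at heq this ⊢
  omega

/-- `2 · #{T(hyb_j) ∧ u_j = β} = H_{j+1}`. [cite: Hirahara2021, Lemma 3.14 (proof)] -/
theorem two_mul_card_acc_eq :
    2 * (univ.filter fun q : (Fin k → BVec n) × BVec k => T q.1 (hyb j x q.1 q.2) = true ∧ q.2 j = x ⬝ᵥ q.1 j).card =
      H T x ((j : ℕ) + 1) := by
  classical
  have hflip := flip_invol (n := n) j
  -- with `u_j` real, `hyb_j = hyb_{j+1}`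
  have h1 : (univ.filter fun q : (Fin k → BVec n) × BVec k => T q.1 (hyb j x q.1 q.2) = true ∧ q.2 j = x ⬝ᵥ q.1 j) =
      univ.filter fun q : (Fin k → BVec n) × BVec k => T q.1 (hyb ((j : ℕ) + 1) x q.1 q.2) = true ∧ q.2 j = x ⬝ᵥ q.1 j := by
    refine Finset.filter_congr fun q _ => ?_
    constructor
    · rintro ⟨h, hu⟩; exact ⟨by rwa [← hyb_eq_hyb_succ_of_eq j x q.1 q.2 hu], hu⟩
    · rintro ⟨h, hu⟩; exact ⟨by rwa [hyb_eq_hyb_succ_of_eq j x q.1 q.2 hu], hu⟩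
  -- flipping `u_j` preserves `hyb_{j+1}`
  have h2 : (univ.filter fun q : (Fin k → BVec n) × BVec k => T q.1 (hyb ((j : ℕ) + 1) x q.1 q.2) = true ∧ q.2 j = x ⬝ᵥ q.1 j).card =
      (univ.filter fun q : (Fin k → BVec n) × BVec k => T q.1 (hyb ((j : ℕ) + 1) x q.1 q.2) = true ∧ q.2 j ≠ x ⬝ᵥ q.1 j).card := by
    refine Finset.card_bij' (fun q _ => (q.1, q.2 + Pi.single j 1)) (fun q _ => (q.1, q.2 + Pi.single j 1))
      (fun q hq => ?_) (fun q hq => ?_) (fun q _ => hflip q) (fun q _ => hflip q)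
    · simp only [mem_filter, mem_univ, true_and] at hq ⊢
      rw [hyb_succ_flip, flip_apply_self, ne_eq, (SipserHash.zmod2_add_one_eq_iff _ _).not, not_not]; exact hq
    · simp only [mem_filter, mem_univ, true_and] at hq ⊢
      rw [hyb_succ_flip, flip_apply_self, SipserHash.zmod2_add_one_eq_iff]; exact hq
  have h3 := Finset.card_filter_add_card_filter_not
    (s := univ.filter fun q : (Fin k → BVec n) × BVec k => T q.1 (hyb ((j : ℕ) + 1) x q.1 q.2) = true)
    (fun q => q.2 j = x ⬝ᵥ q.1 j)
  rw [Finset.filter_filter, Finset.filter_filter] at h3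
  rw [h1, H, ← h3, h2]
  ring

/-- `#{T(hyb_j) ∧ u_j = β} + #{T(hyb_j) ∧ u_j ≠ β} = H_j`. [folklore] -/
theorem card_acc_add_card_acc_ne :
    (univ.filter fun q : (Fin k → BVec n) × BVec k => T q.1 (hyb j x q.1 q.2) = true ∧ q.2 j = x ⬝ᵥ q.1 j).card +
      (univ.filter fun q : (Fin k → BVec n) × BVec k => T q.1 (hyb j x q.1 q.2) = true ∧ q.2 j ≠ x ⬝ᵥ q.1 j).card =
      H T x j := by
  classical
  have h3 := Finset.card_filter_add_card_filter_not
    (s := univ.filter fun q : (Fin k → BVec n) × BVec k => T q.1 (hyb j x q.1 q.2) = true)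
    (fun q => q.2 j = x ⬝ᵥ q.1 j)
  rw [Finset.filter_filter, Finset.filter_filter] at h3
  rw [H, ← h3]

/-- **The exact count of `Q`**: `2·#{Q} + 2·H_j = 2·H_{j+1} + #C`. [cite: Hirahara2021, Lemma 3.14 (proof)] -/
theorem two_mul_card_Q_eq :
    2 * (univ.filter fun q : (Fin k → BVec n) × BVec k => Q T j x q).card + 2 * H T x j =
      2 * H T x ((j : ℕ) + 1) + Fintype.card ((Fin k → BVec n) × BVec k) := by
  classical
  -- split `Q` along `u_j = β`
  have hsplit : (univ.filter fun q : (Fin k → BVec n) × BVec k => Q T j x q).card =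
      (univ.filter fun q : (Fin k → BVec n) × BVec k => T q.1 (hyb j x q.1 q.2) = true ∧ q.2 j = x ⬝ᵥ q.1 j).card +
        (univ.filter fun q : (Fin k → BVec n) × BVec k => ¬ T q.1 (hyb j x q.1 q.2) = true ∧ q.2 j ≠ x ⬝ᵥ q.1 j).card := by
    rw [← Finset.card_union_of_disjoint]
    · congr 1
      ext q
      simp only [mem_filter, mem_univ, true_and, mem_union, Q]
      by_cases hT : T q.1 (hyb j x q.1 q.2) = true
      · simp [hT]
      · simp [hT, SipserHash.zmod2_add_one_eq_iff]
    · rw [Finset.disjoint_filter]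
      rintro q - ⟨h, -⟩ ⟨h', -⟩
      exact h' h
  -- the rejected-and-unequal count through the unequal count
  have hne := Finset.card_filter_add_card_filter_not
    (s := univ.filter fun q : (Fin k → BVec n) × BVec k => q.2 j ≠ x ⬝ᵥ q.1 j)
    (fun q => T q.1 (hyb j x q.1 q.2) = true)
  rw [Finset.filter_filter, Finset.filter_filter] at hne
  have hcomm : (univ.filter fun q : (Fin k → BVec n) × BVec k => q.2 j ≠ x ⬝ᵥ q.1 j ∧ T q.1 (hyb j x q.1 q.2) = true) =
      univ.filter fun q : (Fin k → BVec n) × BVec k => T q.1 (hyb j x q.1 q.2) = true ∧ q.2 j ≠ x ⬝ᵥ q.1 j :=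
    Finset.filter_congr fun q _ => and_comm
  have hcomm' : (univ.filter fun q : (Fin k → BVec n) × BVec k => q.2 j ≠ x ⬝ᵥ q.1 j ∧ ¬ T q.1 (hyb j x q.1 q.2) = true) =
      univ.filter fun q : (Fin k → BVec n) × BVec k => ¬ T q.1 (hyb j x q.1 q.2) = true ∧ q.2 j ≠ x ⬝ᵥ q.1 j :=
    Finset.filter_congr fun q _ => and_comm
  rw [hcomm, hcomm'] at hne
  have hhalf := two_mul_card_ne_eq j x (n := n) (k := k)
  have hacc := two_mul_card_acc_eq T j x
  have hsum := card_acc_add_card_acc_ne T j x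
  omega

/-- **The exact agreement identity** (sign `0`):
`2·#{(c, r) | predZ = ⟨x, r⟩} + 2ⁿ·2H_j = 2ⁿ·(2H_{j+1} + #C)`. [cite: Hirahara2021, Lemma 3.14 (proof)] -/
theorem two_mul_card_agree_eq :
    2 * (univ.filter fun p : ((Fin k → BVec n) × BVec k) × BVec n => predZ T j 0 x p.1 p.2 = x ⬝ᵥ p.2).card +
        2 ^ n * (2 * H T x j) =
      2 ^ n * (2 * H T x ((j : ℕ) + 1) + Fintype.card ((Fin k → BVec n) × BVec k)) := by
  rw [card_agree_zero_eq, ← two_mul_card_Q_eq T j x]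
  ring

/-- Flipping the sign complements the agreement set. [folklore] -/
theorem card_agree_one_eq :
    (univ.filter fun p : ((Fin k → BVec n) × BVec k) × BVec n => predZ T j 1 x p.1 p.2 = x ⬝ᵥ p.2).card +
      (univ.filter fun p : ((Fin k → BVec n) × BVec k) × BVec n => predZ T j 0 x p.1 p.2 = x ⬝ᵥ p.2).card =
      Fintype.card (((Fin k → BVec n) × BVec k) × BVec n) := by
  classical
  have h := Finset.card_filter_add_card_filter_not (s := (univ : Finset (((Fin k → BVec n) × BVec k) × BVec n)))
    (fun p => predZ T j 0 x p.1 p.2 = x ⬝ᵥ p.2)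
  rw [card_univ] at h
  have hcongr : (univ.filter fun p : ((Fin k → BVec n) × BVec k) × BVec n => predZ T j 1 x p.1 p.2 = x ⬝ᵥ p.2) =
      univ.filter fun p : ((Fin k → BVec n) × BVec k) × BVec n => ¬ (predZ T j 0 x p.1 p.2 = x ⬝ᵥ p.2) := by
    refine Finset.filter_congr fun p _ => ?_
    simp only [predZ, add_zero]
    exact SipserHash.zmod2_add_one_eq_iff _ _
  rw [hcongr, add_comm]
  exact h

end Identity

/-! ### The agreement with the right sign -/

/-- **Yao's predictor agrees with `⟨x, ·⟩` on a `1/2 + |H_{j+1} − H_j|/#C` fraction** of (coins, query),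
for the sign matching the sign of `H_{j+1} − H_j`. [cite: Hirahara2021, Lemma 3.14 (proof)] -/
theorem card_agree_ge (T : (Fin k → BVec n) → BVec k → Bool) (j : Fin k) (x : BVec n) :
    ∃ sgn : ZMod 2,
      (1 / 2 + |(H T x ((j : ℕ) + 1) : ℝ) - H T x j| / Fintype.card ((Fin k → BVec n) × BVec k)) *
          (Fintype.card ((Fin k → BVec n) × BVec k) * Fintype.card (BVec n)) ≤
        ((univ.filter fun p : ((Fin k → BVec n) × BVec k) × BVec n => predZ T j sgn x p.1 p.2 = x ⬝ᵥ p.2).card : ℝ) := by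
  have hC : (0 : ℝ) < Fintype.card ((Fin k → BVec n) × BVec k) := Nat.cast_pos.2 Fintype.card_pos
  have hB : (Fintype.card (BVec n) : ℝ) = 2 ^ n := by
    rw [Fintype.card_fun, ZMod.card, Fintype.card_fin]; push_cast; ring
  have h0 := two_mul_card_agree_eq T j x
  have h1 := card_agree_one_eq T j x
  have h0' : 2 * ((univ.filter fun p : ((Fin k → BVec n) × BVec k) × BVec n => predZ T j 0 x p.1 p.2 = x ⬝ᵥ p.2).card : ℝ) +
      2 ^ n * (2 * (H T x j : ℝ)) = 2 ^ n * (2 * (H T x ((j : ℕ) + 1) : ℝ) + Fintype.card ((Fin k → BVec n) × BVec k)) := by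
    exact_mod_cast h0
  have h1' : ((univ.filter fun p : ((Fin k → BVec n) × BVec k) × BVec n => predZ T j 1 x p.1 p.2 = x ⬝ᵥ p.2).card : ℝ) +
      ((univ.filter fun p : ((Fin k → BVec n) × BVec k) × BVec n => predZ T j 0 x p.1 p.2 = x ⬝ᵥ p.2).card : ℝ) =
      Fintype.card ((Fin k → BVec n) × BVec k) * 2 ^ n := by
    have : (Fintype.card (((Fin k → BVec n) × BVec k) × BVec n) : ℝ) = Fintype.card ((Fin k → BVec n) × BVec k) * 2 ^ n := by
      rw [Fintype.card_prod, Nat.cast_mul, hB]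
    rw [← this]; exact_mod_cast h1
  rw [hB]
  rcases le_or_gt (H T x j : ℝ) (H T x ((j : ℕ) + 1)) with hle | hlt
  · refine ⟨0, ?_⟩
    rw [abs_of_nonneg (by linarith)]
    field_simp
    nlinarith [hC]
  · refine ⟨1, ?_⟩
    rw [abs_of_neg (by linarith)]
    field_simp
    nlinarith [hC]

/-! ### Lemma 3.14, counting form -/

/-- **Hirahara 2021, Lemma 3.14 (reconstruction for `DP_k` with a `k`-bit advice), counting form.**
Let the test `T` on (blocks, bits) `δ`-distinguish `DP_k(x; ·)` from uniform in counts,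
`|2^k·Re − Id| ≥ δ·#C` (`Re = #{z | T(z, (⟨x,zᵢ⟩)ᵢ)}`, `Id = #{(z,u) | T(z,u)}`, `#C = 2^{kn}·2^k`), and let
`2^kk − 1 ≥ n / (2(δ/4k)²)`. Then for some block `j` and sign `sgn`, Rackoff's candidate computed from
Yao's predictor `predZ T j sgn x c` with seeds `s` and guess `τ` equals `x` for at least a
`δ/(8k·2^kk)` fraction of the triples `(c, s, τ)`: telescoping (`exists_hybrid_gap`) gives a pair of
hybrids with gap `≥ δ/k`, Yao's predictor then agrees with `⟨x, ·⟩` on a `1/2 + δ/k` fraction of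
(coins, query) (`card_agree_ge`), a `δ/k` fraction of the coins has agreement `≥ 1/2 + δ/2k`
(`card_goodRows_ge`), on those half of the seeds decode (`GLPred.goldreich_levin_cand`), and the guess is
right once in `2^kk`. The advice is the `j` real bits fed below block `j`.
[Hirahara 2021 (ECCC TR21-058), Lemma 3.14 (pp. 23–24); Arora–Barak 2009, Thms. 9.11–9.12]
[cite: Hirahara2021, Lemma 3.14] -/
theorem reconstruction_count (T : (Fin k → BVec n) → BVec k → Bool) (x : BVec n) (hk : 0 < k) {δ : ℝ} (hδ : 0 < δ)
    (hadv : δ * Fintype.card ((Fin k → BVec n) × BVec k) ≤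
      |2 ^ k * ((univ.filter fun z : Fin k → BVec n => T z (fun i => x ⬝ᵥ z i) = true).card : ℝ) -
        ((univ.filter fun q : (Fin k → BVec n) × BVec k => T q.1 q.2 = true).card : ℝ)|)
    {kk : ℕ} (hkk : 0 < kk) (hm : (n : ℝ) ≤ 2 * (δ / k / 4) ^ 2 * (2 ^ kk - 1 : ℕ)) :
    ∃ (j : Fin k) (sgn : ZMod 2),
      δ / k / 8 / 2 ^ kk * Fintype.card (((Fin k → BVec n) × BVec k) × (Fin kk → BVec n) × (Fin kk → ZMod 2)) ≤
        ((univ.filter fun t : ((Fin k → BVec n) × BVec k) × (Fin kk → BVec n) × (Fin kk → ZMod 2) =>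
          glCandidate (predZ T j sgn x t.1) kk t.2.1 t.2.2 = x).card : ℝ) := by
  classical
  have hC : (0 : ℝ) < Fintype.card ((Fin k → BVec n) × BVec k) := Nat.cast_pos.2 Fintype.card_pos
  have hk' : (0 : ℝ) < k := by exact_mod_cast hk
  -- Step 0: telescoping
  obtain ⟨j, hj⟩ := exists_hybrid_gap T x hk
  rw [H_of_le T x le_rfl, H_zero] at hj
  push_cast at hj
  -- the gap at `j`, as a fraction `ε ≥ δ/k` of the coin space
  set ε : ℝ := |(H T x ((j : ℕ) + 1) : ℝ) - H T x j| / Fintype.card ((Fin k → BVec n) × BVec k) with hε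
  have hεδ : δ / k ≤ ε := by
    rw [hε, le_div_iff₀ hC, div_mul_eq_mul_div, div_le_iff₀ hk']
    calc δ * Fintype.card ((Fin k → BVec n) × BVec k) ≤ _ := hadv
      _ ≤ k * |(H T x ((j : ℕ) + 1) : ℝ) - H T x j| := hj
      _ = |(H T x ((j : ℕ) + 1) : ℝ) - H T x j| * k := mul_comm _ _
  have hε0 : 0 < ε := lt_of_lt_of_le (by positivity) hεδ
  -- Step 1: the sign and the global agreement
  obtain ⟨sgn, hagree⟩ := card_agree_ge T j x
  rw [← hε] at hagree
  refine ⟨j, sgn, ?_⟩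
  -- Step 2: a `≥ ε` fraction of the coins has agreement `≥ 1/2 + ε/2`
  have hrows := card_goodRows_ge (A := (Fin k → BVec n) × BVec k) (B := BVec n)
    (fun c r => predZ T j sgn x c r = x ⬝ᵥ r) hε0.le hagree
  set good := univ.filter fun c : (Fin k → BVec n) × BVec k =>
    (1 / 2 + ε / 2) * Fintype.card (BVec n) ≤ ((univ.filter fun r => predZ T j sgn x c r = x ⬝ᵥ r).card : ℝ) with hgood
  -- Step 3: on good coins, half of the seeds decode under the true guess
  have hm' : (n : ℝ) ≤ 2 * (ε / 2) ^ 2 * (2 ^ kk - 1 : ℕ) := by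
    refine hm.trans ?_
    have h1 : δ / k / 4 ≤ ε / 2 := by linarith
    have h2 : (0 : ℝ) ≤ δ / k / 4 := by positivity
    have h3 : (0 : ℝ) ≤ (2 ^ kk - 1 : ℕ) := Nat.cast_nonneg _
    have := mul_le_mul h1 h1 h2 (by linarith)
    nlinarith
  have hGL : ∀ c ∈ good, (Fintype.card (Fin kk → BVec n) : ℝ) / 2 ≤
      ((univ.filter fun s : Fin kk → BVec n => glCandidate (predZ T j sgn x c) kk s (trueGuess x s) = x).card : ℝ) := by
    intro c hc
    exact GLPred.goldreich_levin_cand (predZ T j sgn x c) x (γ := ε / 2) (by positivity) (mem_filter.1 hc).2 hkk hm'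
  -- Step 4: count the successes through `(c, s) ↦ (c, s, trueGuess)`
  set succ := univ.filter fun t : ((Fin k → BVec n) × BVec k) × (Fin kk → BVec n) × (Fin kk → ZMod 2) =>
    glCandidate (predZ T j sgn x t.1) kk t.2.1 t.2.2 = x with hsucc
  have hinj : (good.sigma fun c => univ.filter fun s : Fin kk → BVec n =>
      glCandidate (predZ T j sgn x c) kk s (trueGuess x s) = x).card ≤ succ.card := by
    refine Finset.card_le_card_of_injOn (fun q => (q.1, q.2, trueGuess x q.2)) (fun q hq => ?_) ?_
    · rw [Finset.mem_coe, Finset.mem_sigma] at hq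
      rw [Finset.mem_coe]
      simp only [hsucc, mem_filter, mem_univ, true_and]
      exact (mem_filter.1 hq.2).2
    · rintro ⟨c, s⟩ _ ⟨c', s'⟩ _ h
      simp only [Prod.mk.injEq] at h
      obtain ⟨rfl, rfl, -⟩ := h
      rfl
  have hsum : (good.card : ℝ) * ((Fintype.card (Fin kk → BVec n) : ℝ) / 2) ≤
      ((good.sigma fun c => univ.filter fun s : Fin kk → BVec n =>
        glCandidate (predZ T j sgn x c) kk s (trueGuess x s) = x).card : ℝ) := by
    rw [Finset.card_sigma, Nat.cast_sum, ← nsmul_eq_mul, ← Finset.sum_const]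
    exact Finset.sum_le_sum hGL
  -- Step 5: arithmetic
  have htot : (Fintype.card (((Fin k → BVec n) × BVec k) × (Fin kk → BVec n) × (Fin kk → ZMod 2)) : ℝ) =
      Fintype.card ((Fin k → BVec n) × BVec k) * Fintype.card (Fin kk → BVec n) * 2 ^ kk := by
    have h2 : Fintype.card (Fin kk → ZMod 2) = 2 ^ kk := by
      rw [Fintype.card_fun, ZMod.card, Fintype.card_fin]
    have h1 : Fintype.card (((Fin k → BVec n) × BVec k) × (Fin kk → BVec n) × (Fin kk → ZMod 2)) =
        Fintype.card ((Fin k → BVec n) × BVec k) * (Fintype.card (Fin kk → BVec n) * Fintype.card (Fin kk → ZMod 2)) := by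
      rw [Fintype.card_prod, Fintype.card_prod, Fintype.card_prod]
    rw [h1, h2]; push_cast; ring
  rw [htot]
  have hS : (0 : ℝ) ≤ Fintype.card (Fin kk → BVec n) := Nat.cast_nonneg _
  have h2k : (0 : ℝ) < 2 ^ kk := by positivity
  have hgoodge : δ / k * Fintype.card ((Fin k → BVec n) × BVec k) ≤ good.card :=
    (mul_le_mul_of_nonneg_right hεδ hC.le).trans hrows
  calc δ / k / 8 / 2 ^ kk * (Fintype.card ((Fin k → BVec n) × BVec k) * Fintype.card (Fin kk → BVec n) * 2 ^ kk)
      = (δ / k * Fintype.card ((Fin k → BVec n) × BVec k)) * ((Fintype.card (Fin kk → BVec n) : ℝ) / 2) / 4 := by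
        field_simp; ring
    _ ≤ (δ / k * Fintype.card ((Fin k → BVec n) × BVec k)) * ((Fintype.card (Fin kk → BVec n) : ℝ) / 2) := by
        have : (0 : ℝ) ≤ (δ / k * Fintype.card ((Fin k → BVec n) × BVec k)) * ((Fintype.card (Fin kk → BVec n) : ℝ) / 2) := by
          positivity
        linarith
    _ ≤ (good.card : ℝ) * ((Fintype.card (Fin kk → BVec n) : ℝ) / 2) := by gcongr
    _ ≤ _ := hsum
    _ ≤ (succ.card : ℝ) := by exact_mod_cast hinj

end DPHyb

end Literature.Computability.MetaComplexity
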